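/-
Literature file (hubbard-downfold router, R2 «f-box» and local-moment rows): the mean-field Curie–Weiss dictionary
between a measured paramagnetic Curie–Weiss temperature `Θ`, a nearest-neighbour exchange constant `J` under the three
Hamiltonian conventions that appear in the router's sources, and a DFT energy difference; plus the de Gennes factor
`(g_J − 1)² J(J + 1)` of a Hund ground term, with the `RBa₂Cu₃O₇₋δ` rare-earth ordering temperatures as witnesses.
-/
import Mathlib
import HarnessLib
import Literature.MathematicalPhysics.QuantumManyBody.HundRulesEffectiveMoment

/-!
# Curie–Weiss mean field: `Θ ↔ J` by Hamiltonian convention, and the de Gennes factor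

Kittel [Kittel1971, ch. 15, «Curie–Weiss law» and the exchange-integral paragraph] writes the Heisenberg coupling of a
pair of neighbouring spins as `U = −2J S_i·S_j` and obtains, in mean field, `J = 3k_B T_c/(2 z S(S+1))`, i.e.
`Θ = 2 z J S(S+1)/(3 k_B)` for `z` equivalent neighbours. The sources quoted in the hubbard-downfold literature tables
use THREE pair conventions for the same physics:

* (K) `H = −2J Σ_⟨ij⟩ S_i·S_j` (Kittel; Smylie et al. 2018 write `Θ_C = 2[zJ + z′J′]S(S+1)/3k_B` for `RbEuFe₄As₄`):
  `Θ = 2 z J S(S+1)/3` — `thetaKittel`;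
* (S) `H = −J Σ_⟨ij⟩ S_i·S_j` (single `J`, ferromagnetic positive): `Θ = z J S(S+1)/3` — `thetaSingle`;
* (AF) `H = +J Σ_⟨ij⟩ S_i·S_j` (antiferromagnetic positive; Iida et al. 2019's spin-wave Hamiltonian for `RbEuFe₄As₄`,
  `J₁/k_B = −1.31 K`): `Θ = −z J S(S+1)/3` — `thetaAF`;

(all in kelvin when `J` is quoted as `J/k_B` in kelvin; sums over unordered pairs — a sum over ORDERED pairs doubles the
physical pair coupling, `thetaAF_orderedPairs`). This file types the three maps, their exact relations (`J_S = 2J_K`,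
`J_AF = −J_S`), linearity and additivity over neighbour shells (Smylie's `zJ + z′J′`), the inversion `J = 3Θ/(2zS(S+1))`,
and decidable witnesses: Smylie's «∼ 0.6 K» from `Θ_C = 23 K`, `S = 7/2`, `z = 4` is certified as `0.54 < J < 0.55`
(`0.57 < J < 0.58` from the (100)-axis `Θ = 24.18 K`); Iida's `J₁ = −1.31 K` gives a mean-field `Θ = 27.51 K` if the
printed `Σ_{i,j}` counts pairs once and `55.02 K` if it counts ordered pairs, against the measured `Θ_C ∈ [22.32, 24.18] K`
— so the per-pair reading is the one consistent with the susceptibility (a located convention check, not a fit).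

§3 types the de Gennes factor `G = (g_J − 1)² J(J+1)` [MarkertDalichaouchMaple1989, Eq. (1): the pair-breaking /
RKKY-ordering scale «scales with … (g_J − 1)² J(J+1)»] on the Hund ground terms of `HundRulesEffectiveMoment.lean`, the
exact values for `Pr³⁺ … Er³⁺`, and the `RBa₂Cu₃O₇₋δ` rare-earth ordering temperatures printed in the same chapter
(«0.52 K for Nd, 0.61 K for Sm, 2.25 K for Gd, 0.90 K for Dy, 0.17 K for Ho, and 0.60 K for Er», p. 233): scaled from Gd,
de Gennes predicts Sm 0.64 / Dy 1.01 / Er 0.36 / Nd 0.26 K (within a factor 2 of print) and **Pr 0.114 K — two orders of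
magnitude below the measured `T_N(Pr) ≈ 14–17 K` of `PrBa₂Cu₃O₇`** («unusually high Néel temperature … indicates that Pr f
states are present at the Fermi level», Mazin 1999): the quantitative content of the PrBa₂Cu₃O₇ anomaly.

§4: `k_B` in meV K⁻¹ from the exact SI constants (`0.086173 < k_B < 0.086174`) and the NdH₉ arithmetic of Zhou et al.
2020 (`T_N^MF = min|E_FM − E_AFM|/6k_B ≈ 136 K` ⇔ `|ΔE| ≈ 70.3 meV`).

§5 types the Rhodes–Wohlfarth carrier moment `p_C` (`p_C(p_C+2) = p_eff²`, i.e. `p_C = √(1+p_eff²) − 1`) and the ratio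
`p_C/p_s` [Rhodes & Wohlfarth 1963; the formula as printed in Liu–Ivanovski–Petrovic 2017, p. 5: «RWR is 1 for a localized
system and is larger in an itinerant system»], proves the local-moment consistency `p_C(√(4S(S+1))) = 2S` (ratio exactly 1;
the `f⁷` ion gives `p_C = 7`), monotonicity, and certifies the three `f` rows the hubbard-downfold literature key separates:
`RbEuFe₄As₄` (Eu²⁺ spectator: `μ_eff` 7.95, `M_sat` 6.5 ⇒ ratio 1.07), `UGe₂` («duality»: `μ_eff` 2.7 vs ordered 1.48 / 1.42
⇒ 1.27 / 1.32) and `UCoGe` (itinerant weak ferromagnet: `μ_eff` 1.7 vs `m₀` 0.03–0.07 ⇒ 14–32), in that order.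

WHAT THIS IS NOT: a claim that mean field gives the ordering temperature of a quasi-2D magnet (it gives `Θ`, the
high-temperature Curie–Weiss intercept, exactly to leading order in `1/T`; `T_m = 15 K < Θ = 23 K` for `RbEuFe₄As₄` is the
printed fluctuation suppression), nor an adjudication of which `J` is «right». No named facts.

## References
* C. Kittel, *Introduction to Solid State Physics*, 4th ed. (Wiley 1971), ch. 15 (ferromagnetism: Curie–Weiss law and
  the mean-field exchange integral `J = 3k_BT_c/2zS(S+1)`). [Kittel1971]
* M. P. Smylie et al., Phys. Rev. B 98 (2018) 104503, arXiv:1805.04216, p. 4–5 (`RbEuFe₄As₄`: `Θ_C` by axis 24.18 /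
  23.81 / 22.32 K, `Θ_C = 2[zJ + z′J′]S(S+1)/3k_B`, `J ∼ 0.6 K`, `z = 4`). [SmylieEtAl2018RbEuFe4As4]
* K. Iida et al., Phys. Rev. B 100 (2019) 014506, arXiv:1907.03839, p. 1 and 5 (`H = J₁ΣS_i·S_j + J_cΣS_i·S_j`,
  `S = 7/2`, `J₁/k_B = −1.31(1) K`, `J_c/k_B = 0.08 K`). [IidaEtAl2019EuRbFe4As4]
* J. T. Markert, Y. Dalichaouch, M. B. Maple, in *Physical Properties of High Temperature Superconductors I*
  (D. M. Ginsberg ed., World Scientific 1989), ch. 6, Eq. (1) (de Gennes factor) and p. 233 (rare-earth `T_M` list).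
  [MarkertDalichaouchMaple1989]
* D. Zhou et al., J. Am. Chem. Soc. 142 (2020) 2803, arXiv:1908.08304, p. 13 and SI p. 31 (`T_N^MF ≈ 136 K` for
  `NdH₉` from `min|E_FM − E_AFM|/6k_B`). [ZhouEtAl2020NdH9]
* BIPM, *The International System of Units*, 9th ed. (2019), §2.2 Table 1 (exact `k_B`, `e`). [BIPM2019]
* P. Rhodes, E. P. Wohlfarth, Proc. R. Soc. London A 273 (1963) 247 (the effective Curie–Weiss constant of
  ferromagnetic metals; origin of `p_C/p_s`). [RhodesWohlfarth1963]
* Y. Liu, V. N. Ivanovski, C. Petrovic, Phys. Rev. B 96 (2017) 144429, arXiv:1803.05905, p. 5 (`P_c(P_c+2) = P_eff²`,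
  RWR = `P_c/P_s`, «1 for a localized system»). [LiuIvanovskiPetrovic2017Fe3GeTe2]
* A. B. Shick, W. E. Pickett, Phys. Rev. Lett. 86 (2001) 300, arXiv:cond-mat/0011026, p. 2 (`UGe₂`: `m_eff ≈ 2.7 μ_B/U`
  vs `3.62` for `f³`; ordered `1.42 μ_B`; `T_C = 52 K`). [ShickPickett2001UGe2]
* D. Aoki, K. Ishida, J. Flouquet, J. Phys. Soc. Jpn. 88 (2019) 022001, arXiv:1901.00684, Table I (`UGe₂` / `URhGe` /
  `UCoGe`: `M₀` 1.48 / 0.4 / 0.06 μ_B, `γ` 34 / 163 / 57) and §2.1 (duality vs itinerant). [AokiIshidaFlouquet2019UFMSC]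
* P. de la Mora, O. Navarro, J. Phys.: Condens. Matter 20 (2008) 285221, arXiv:0709.2351, p. 2 (`UCoGe` `μ_eff = 1.7 μ_B`).
  [MoraNavarro2008UCoGe]
* S. Fujimori et al., Phys. Rev. B 91 (2015) 174503, arXiv:1505.01898, p. 1 (`UCoGe` `μ_ord = 0.03 μ_B`, «itinerant weak
  ferromagnet»). [FujimoriEtAl2015UGe2UCoGeARPES]
* Y. Liu et al., Phys. Rev. B 93 (2016) 214503, arXiv:1605.04396, p. 4–5 (`RbEuFe₄As₄`: saturation 6.5 μ_B/Eu vs gS = 7;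
  `μ_eff = 7.95 μ_B`). [LiuEtAl2016RbEuFe4As4]
-/

noncomputable section

namespace Literature.MathematicalPhysics.QuantumManyBody

namespace CurieWeiss

/-! ## §1 The three pair conventions and the mean-field Curie–Weiss temperature -/

/-- `S(S+1)`. [cite: Kittel1971, ch. 15 (Curie–Weiss law)] -/
def spinSq (S : ℝ) : ℝ := S * (S + 1)

/-- Convention (K), `H = −2J Σ_⟨ij⟩ S_i·S_j`: `Θ = 2 z J S(S+1)/3` (kelvin, `J` as `J/k_B`).
[cite: Kittel1971, ch. 15 (`J = 3k_BT_c/2zS(S+1)`)]; [cite: SmylieEtAl2018RbEuFe4As4, p. 5 (`Θ_C = 2[zJ+z′J′]S(S+1)/3k_B`)] -/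
def thetaKittel (z J S : ℝ) : ℝ := 2 * z * J * spinSq S / 3

/-- Convention (S), `H = −J Σ_⟨ij⟩ S_i·S_j`: `Θ = z J S(S+1)/3`. [cite: Kittel1971, ch. 15] -/
def thetaSingle (z J S : ℝ) : ℝ := z * J * spinSq S / 3

/-- Convention (AF), `H = +J Σ_⟨ij⟩ S_i·S_j` (pairs once): `Θ = −z J S(S+1)/3`.
[cite: IidaEtAl2019EuRbFe4As4, p. 5 (spin Hamiltonian)]; [cite: Kittel1971, ch. 15] -/
def thetaAF (z J S : ℝ) : ℝ := -(z * J * spinSq S / 3)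

/-- Convention (AF) with the sum over ORDERED pairs `Σ_{i≠j}` (each bond twice): the physical pair coupling is `2J`,
`Θ = −2 z J S(S+1)/3`. [cite: Kittel1971, ch. 15] -/
def thetaAF_orderedPairs (z J S : ℝ) : ℝ := -(2 * z * J * spinSq S / 3)

/-- (S) vs (K): the same physics needs `J_S = 2 J_K`, i.e. `thetaSingle z J S = thetaKittel z (J/2) S`.
[cite: Kittel1971, ch. 15] -/
theorem thetaSingle_eq_thetaKittel_half (z J S : ℝ) : thetaSingle z J S = thetaKittel z (J / 2) S := by
  unfold thetaSingle thetaKittel; ring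

/-- (AF) vs (S): `J_AF = −J_S`. [cite: Kittel1971, ch. 15] -/
theorem thetaAF_eq_thetaSingle_neg (z J S : ℝ) : thetaAF z J S = thetaSingle z (-J) S := by
  unfold thetaAF thetaSingle; ring

/-- Ordered-pair sums double the coupling: `thetaAF_orderedPairs z J S = thetaAF z (2J) S = 2 · thetaAF z J S`.
[cite: Kittel1971, ch. 15] -/
theorem thetaAF_orderedPairs_eq (z J S : ℝ) :
    thetaAF_orderedPairs z J S = thetaAF z (2 * J) S ∧ thetaAF_orderedPairs z J S = 2 * thetaAF z J S := by
  unfold thetaAF_orderedPairs thetaAF; constructor <;> ring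

/-- Linearity in `J`. [cite: Kittel1971, ch. 15] -/
theorem thetaKittel_smul (z J S c : ℝ) : thetaKittel z (c * J) S = c * thetaKittel z J S := by
  unfold thetaKittel; ring

/-- ADDITIVITY OVER NEIGHBOUR SHELLS: `Θ(z, J) + Θ(z′, J′) = 2[zJ + z′J′]S(S+1)/3` — Smylie et al.'s two-shell form.
[cite: SmylieEtAl2018RbEuFe4As4, p. 5 (`Θ_C = 2[zJ + z′J′]S(S+1)/3k_B`)] -/
theorem thetaKittel_add_shell (z J z' J' S : ℝ) :
    thetaKittel z J S + thetaKittel z' J' S = 2 * (z * J + z' * J') * spinSq S / 3 := by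
  unfold thetaKittel; ring

/-- Sign: ferromagnetic `J > 0` (K) with `z, S > 0` gives `Θ > 0`. [cite: Kittel1971, ch. 15] -/
theorem thetaKittel_pos {z J S : ℝ} (hz : 0 < z) (hJ : 0 < J) (hS : 0 < S) : 0 < thetaKittel z J S := by
  unfold thetaKittel spinSq
  have : 0 < S * (S + 1) := by positivity
  positivity

/-- Monotone in `J` (fixed `z, S > 0`). [cite: Kittel1971, ch. 15] -/
theorem thetaKittel_lt_of_lt {z S J₁ J₂ : ℝ} (hz : 0 < z) (hS : 0 < S) (h : J₁ < J₂) :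
    thetaKittel z J₁ S < thetaKittel z J₂ S := by
  unfold thetaKittel spinSq
  have hc : 0 < 2 * z * (S * (S + 1)) := by positivity
  have h2 := mul_lt_mul_of_pos_right h hc
  have e1 : 2 * z * J₁ * (S * (S + 1)) = J₁ * (2 * z * (S * (S + 1))) := by ring
  have e2 : 2 * z * J₂ * (S * (S + 1)) = J₂ * (2 * z * (S * (S + 1))) := by ring
  rw [e1, e2]
  linarith

/-- INVERSION (Kittel's printed form): `J = 3Θ/(2 z S(S+1))`. [cite: Kittel1971, ch. 15 (`J = 3k_BT_c/2zS(S+1)`)] -/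
def jKittel (θ z S : ℝ) : ℝ := 3 * θ / (2 * z * spinSq S)

/-- Round trip `J(Θ(J)) = J`. [cite: Kittel1971, ch. 15] -/
theorem jKittel_thetaKittel {z S : ℝ} (J : ℝ) (hz : z ≠ 0) (hS : 0 < S) :
    jKittel (thetaKittel z J S) z S = J := by
  unfold jKittel thetaKittel spinSq
  have hSS : S * (S + 1) ≠ 0 := by positivity
  field_simp

/-- Round trip `Θ(J(Θ)) = Θ`. [cite: Kittel1971, ch. 15] -/
theorem thetaKittel_jKittel {z S : ℝ} (θ : ℝ) (hz : z ≠ 0) (hS : 0 < S) :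
    thetaKittel z (jKittel θ z S) S = θ := by
  unfold jKittel thetaKittel spinSq
  have hSS : S * (S + 1) ≠ 0 := by positivity
  field_simp

/-! ## §2 Witnesses: the `Eu²⁺` square lattice of `RbEuFe₄As₄` (`S = 7/2`, `z = 4`) -/

/-- `S(S+1) = 63/4` for `S = 7/2` (Eu²⁺ ⁸S₇/₂). [cite: SmylieEtAl2018RbEuFe4As4, p. 4 («g = 2 and S = 7/2»)] -/
theorem spinSq_seven_halves : spinSq (7 / 2) = 63 / 4 := by
  unfold spinSq; norm_num

/-- Smylie et al.: `Θ_C = 23 K` with `z = 4`, `S = 7/2`, interlayer term dropped ⇒ `J = 69/126 K`, i.e. **`0.54 < J < 0.55 K`**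
(printed «∼ 0.6 K»). [cite: SmylieEtAl2018RbEuFe4As4, p. 5 («J … is ∼ 0.6 K … z = 4»)] -/
theorem smylie2018_J_from_theta23 :
    jKittel 23 4 (7 / 2) = 69 / 126 ∧ 0.54 < jKittel 23 4 (7 / 2) ∧ jKittel 23 4 (7 / 2) < 0.55 := by
  unfold jKittel spinSq
  refine ⟨by norm_num, by norm_num, by norm_num⟩

/-- … with the (100)-axis `Θ_C = 24.18 K`: **`0.57 < J < 0.58 K`**; with the (001) value `22.32 K`: `0.53 < J < 0.54 K` — the
by-axis spread of the same reading. [cite: SmylieEtAl2018RbEuFe4As4, p. 4 («Θ_C of 24.18 K, 23.81 K and 22.32 K»)] -/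
theorem smylie2018_J_by_axis :
    (0.57 < jKittel 24.18 4 (7 / 2) ∧ jKittel 24.18 4 (7 / 2) < 0.58) ∧
      (0.53 < jKittel 22.32 4 (7 / 2) ∧ jKittel 22.32 4 (7 / 2) < 0.54) := by
  unfold jKittel spinSq
  refine ⟨⟨by norm_num, by norm_num⟩, ⟨by norm_num, by norm_num⟩⟩

/-- Iida et al.'s spin-wave `J₁/k_B = −1.31 K` in `H = J₁ Σ S_i·S_j` (AF-positive sign, FM negative), `z = 4`, `S = 7/2`:
READ AS A SUM OVER PAIRS the mean-field Curie–Weiss temperature is **`Θ = 27.51 K`**; READ AS A SUM OVER ORDERED PAIRS it is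
**`55.02 K`**. [cite: IidaEtAl2019EuRbFe4As4, p. 1 and p. 5 («J₁/k_B = −1.31 K»)] -/
theorem iida2019_theta_by_counting :
    thetaAF 4 (-1.31) (7 / 2) = 27.51 ∧ thetaAF_orderedPairs 4 (-1.31) (7 / 2) = 55.02 := by
  unfold thetaAF thetaAF_orderedPairs spinSq
  constructor <;> norm_num

/-- THE CONVENTION CHECK: against the measured `Θ_C ∈ [22.32, 24.18] K` the per-pair reading of Iida's `J₁` overshoots by
`< 24 %` while the ordered-pair reading overshoots by a factor `> 2.2` — the spin-wave `J₁` and the susceptibility `J` are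
the same coupling to within the usual mean-field/LSW spread only under the per-pair reading.
[cite: IidaEtAl2019EuRbFe4As4, p. 5]; [cite: SmylieEtAl2018RbEuFe4As4, p. 4] -/
theorem iida_vs_smylie_convention_check :
    thetaAF 4 (-1.31) (7 / 2) < 1.24 * 22.32 ∧ 2.2 * 24.18 < thetaAF_orderedPairs 4 (-1.31) (7 / 2) := by
  unfold thetaAF thetaAF_orderedPairs spinSq
  constructor <;> norm_num

/-- Equivalently, Iida's per-pair `J₁ = −1.31 K` is `J_K = 0.655 K` in Kittel's convention (vs Smylie's 0.53–0.58 from `Θ`).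
[cite: IidaEtAl2019EuRbFe4As4, p. 5]; [cite: Kittel1971, ch. 15] -/
theorem iida2019_J_in_Kittel_convention :
    thetaAF 4 (-1.31) (7 / 2) = thetaKittel 4 0.655 (7 / 2) := by
  unfold thetaAF thetaKittel spinSq; norm_num

/-- The printed fluctuation suppression: `T_m = 15 K` lies below every measured `Θ_C` (22.32–24.18 K) and below both MF
readings. [cite: SmylieEtAl2018RbEuFe4As4, p. 4 («T_m = 15 K, Θ_C = 23 K»)] -/
theorem rbEuFe4As4_Tm_lt_theta : (15 : ℝ) < 22.32 ∧ (22.32 : ℝ) < thetaAF 4 (-1.31) (7 / 2) := by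
  unfold thetaAF spinSq
  constructor <;> norm_num

/-! ## §3 The de Gennes factor of a Hund ground term and the `RBa₂Cu₃O₇₋δ` rare-earth ordering temperatures -/

/-- THE DE GENNES FACTOR `G = (g_J − 1)² J(J+1)` of a term `(L, S, J)`. [cite: MarkertDalichaouchMaple1989, Eq. (1)
(«scales with … (g_J − 1)² J(J+1)»)] -/
def deGennes (L S J : ℝ) : ℝ := (LocalMoment.landeG L S J - 1) ^ 2 * (J * (J + 1))

/-- The de Gennes factor of the Hund ground term of `l^n`. [cite: MarkertDalichaouchMaple1989, Eq. (1)] -/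
def hundDeGennes (l n : ℕ) : ℝ :=
  deGennes (LocalMoment.hundL l n) (LocalMoment.hundS l n) (LocalMoment.hundJ l n)


/-- Component extraction: if the Hund term of `l^n` is `(L, S, J)` then its de Gennes factor is `deGennes L S J`.
[cite: MarkertDalichaouchMaple1989, Eq. (1)] -/
theorem hundDeGennes_of_term {l n : ℕ} {L S J : ℝ} (h : LocalMoment.hundTerm l n = (L, S, J)) :
    hundDeGennes l n = deGennes L S J := by
  unfold LocalMoment.hundTerm at h
  simp only [Prod.mk.injEq] at h
  obtain ⟨hL, hS, hJ⟩ := h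
  unfold hundDeGennes
  rw [hL, hS, hJ]

/-- For a pure-spin term (`L = 0`, `J = S > 0`, `g = 2`): `G = S(S+1)` — Gd³⁺/Eu²⁺ `f⁷`: `63/4`.
[cite: MarkertDalichaouchMaple1989, Eq. (1)] -/
theorem deGennes_spin_only {S : ℝ} (hS : 0 < S) : deGennes 0 S S = S * (S + 1) := by
  unfold deGennes
  rw [LocalMoment.landeG_spin_only hS]
  ring

/-- `Gd³⁺` (`f⁷`, ⁸S₇/₂): `G = 63/4 = 15.75`. [cite: MarkertDalichaouchMaple1989, Eq. (1) and p. 233 (Gd 2.25 K)] -/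
theorem deGennes_Gd3 : hundDeGennes 3 7 = 63 / 4 := by
  rw [hundDeGennes_of_term LocalMoment.hund_f7]
  unfold deGennes LocalMoment.landeG
  norm_num

/-- `Pr³⁺` (`f²`, ³H₄, `g = 4/5`): `G = 4/5`. [cite: MarkertDalichaouchMaple1989, Eq. (1)] -/
theorem deGennes_Pr3 : hundDeGennes 3 2 = 4 / 5 := by
  rw [hundDeGennes_of_term LocalMoment.hund_f2]
  unfold deGennes LocalMoment.landeG
  norm_num

/-- `Nd³⁺` (`f³`, ⁴I₉/₂, `g = 8/11`): `G = 81/44`. [cite: MarkertDalichaouchMaple1989, Eq. (1) and p. 233 (Nd 0.52 K)] -/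
theorem deGennes_Nd3 : hundDeGennes 3 3 = 81 / 44 := by
  rw [hundDeGennes_of_term LocalMoment.hund_f3]
  unfold deGennes LocalMoment.landeG
  norm_num

/-- `Sm³⁺` (`f⁵`, ⁶H₅/₂, `g = 2/7`): `G = 125/28`. [cite: MarkertDalichaouchMaple1989, Eq. (1) and p. 233 (Sm 0.61 K)] -/
theorem deGennes_Sm3 : hundDeGennes 3 5 = 125 / 28 := by
  rw [hundDeGennes_of_term LocalMoment.hund_f5]
  unfold deGennes LocalMoment.landeG
  norm_num

/-- `Dy³⁺` (`f⁹`, ⁶H₁₅/₂, `g = 4/3`): `G = 85/12`. [cite: MarkertDalichaouchMaple1989, Eq. (1) and p. 233 (Dy 0.90 K)] -/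
theorem deGennes_Dy3 : hundDeGennes 3 9 = 85 / 12 := by
  rw [hundDeGennes_of_term LocalMoment.hund_f9]
  unfold deGennes LocalMoment.landeG
  norm_num

/-- `Ho³⁺` (`f¹⁰`, ⁵I₈, `g = 5/4`): `G = 9/2`. [cite: MarkertDalichaouchMaple1989, Eq. (1) and p. 233 (Ho 0.17 K)] -/
theorem deGennes_Ho3 : hundDeGennes 3 10 = 9 / 2 := by
  rw [hundDeGennes_of_term LocalMoment.hund_f10]
  unfold deGennes LocalMoment.landeG
  norm_num

/-- `Er³⁺` (`f¹¹`, ⁴I₁₅/₂, `g = 6/5`): `G = 51/20`. [cite: MarkertDalichaouchMaple1989, Eq. (1) and p. 233 (Er 0.60 K)] -/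
theorem deGennes_Er3 : hundDeGennes 3 11 = 51 / 20 := by
  rw [hundDeGennes_of_term LocalMoment.hund_f11]
  unfold deGennes LocalMoment.landeG
  norm_num

/-- DE GENNES SCALING FROM `Gd` (`T_M(Gd) = 2.25 K`): `T(R) = 2.25 · G(R)/G(Gd)`. [cite: MarkertDalichaouchMaple1989, Eq. (1) and p. 233] -/
def scaledFromGd (l n : ℕ) : ℝ := 2.25 * hundDeGennes l n / hundDeGennes 3 7

/-- The scaled predictions vs the printed `T_M`: Sm `0.63 < T < 0.64` (printed 0.61), Dy `1.01 < T < 1.02` (0.90),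
Er `0.36 < T < 0.37` (0.60), Nd `0.26 < T < 0.27` (0.52) — de Gennes scaling holds within a factor 2 across the series.
[cite: MarkertDalichaouchMaple1989, p. 233 («0.52 K for Nd, 0.61 K for Sm, 2.25 K for Gd, 0.90 K for Dy, 0.17 K for Ho, and 0.60 K for Er»)] -/
theorem rBa2Cu3O7_deGennes_scaling :
    (0.63 < scaledFromGd 3 5 ∧ scaledFromGd 3 5 < 0.64) ∧ (1.01 < scaledFromGd 3 9 ∧ scaledFromGd 3 9 < 1.02) ∧
      (0.36 < scaledFromGd 3 11 ∧ scaledFromGd 3 11 < 0.37) ∧ (0.26 < scaledFromGd 3 3 ∧ scaledFromGd 3 3 < 0.27) := by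
  unfold scaledFromGd
  rw [deGennes_Sm3, deGennes_Dy3, deGennes_Er3, deGennes_Nd3, deGennes_Gd3]
  norm_num

/-- **THE `PrBa₂Cu₃O₇` ANOMALY, QUANTIFIED**: de Gennes scaling from Gd predicts `0.11 < T_N(Pr) < 0.12 K`, while the printed
Pr ordering temperature is `≥ 14 K` — more than `100 ×` the scaled value (`14 > 100 · scaledFromGd`).
[cite: MarkertDalichaouchMaple1989, p. 243–244 (C(T) peak 16 K, χ deviation 14 K)]; [cite: Mazin1999PrBa2Cu3O7, p. 2
(«unusually high Néel temperature of PrBa₂Cu₃O₇, T_N ≈ 14 K (all other REBa₂Cu₃O₇ have T_N of a few K)»)] -/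
theorem prBa2Cu3O7_TN_vs_deGennes :
    0.11 < scaledFromGd 3 2 ∧ scaledFromGd 3 2 < 0.12 ∧ 100 * scaledFromGd 3 2 < 14 := by
  unfold scaledFromGd
  rw [deGennes_Pr3, deGennes_Gd3]
  refine ⟨by norm_num, by norm_num, by norm_num⟩

/-- Ho is the other outlier, LOW (`0.17 K` printed vs `0.64` scaled: crystal-field singlet ground state), the opposite sign to Pr.
[cite: MarkertDalichaouchMaple1989, p. 233 (Ho 0.17 K)] -/
theorem hoBa2Cu3O7_below_deGennes : 0.17 * 3 < scaledFromGd 3 10 := by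
  unfold scaledFromGd
  rw [deGennes_Ho3, deGennes_Gd3]
  norm_num

/-! ## §4 `k_B` in meV K⁻¹ and the mean-field `T_N ↔ ΔE` arithmetic of the `NdH₉` row -/

/-- `k_B` in meV K⁻¹ from the exact SI values `k_B = 1.380649 × 10⁻²³ J K⁻¹`, `e = 1.602176634 × 10⁻¹⁹ C`.
[cite: BIPM2019, §2.2 Table 1] -/
def kBmeV : ℝ := 1.380649e-23 / 1.602176634e-19 * 1e3

/-- `0.086173 < k_B < 0.086174` meV K⁻¹. [cite: BIPM2019, §2.2 Table 1] -/
theorem kBmeV_bounds : 0.086173 < kBmeV ∧ kBmeV < 0.086174 := by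
  unfold kBmeV; constructor <;> norm_num

/-- The energy `n · k_B T` in meV for a mean-field rule `k_B T = ΔE/n`. [cite: ZhouEtAl2020NdH9, p. 13 (`T_N^MF ≈ min|E_FM − E_AFM|/6k_B`)] -/
def mfEnergy (n T : ℝ) : ℝ := n * kBmeV * T

/-- `NdH₉`: the printed `T_N^MF ≈ 136 K` with the printed `/6k_B` rule corresponds to **`70.3 < |E_FM − E_AFM| < 70.4 meV`**
(in the paper's normalisation). [cite: ZhouEtAl2020NdH9, p. 13 and SI p. 31 («136 K for NdH₉»)] -/
theorem ndH9_mf_energy : 70.3 < mfEnergy 6 136 ∧ mfEnergy 6 136 < 70.4 := by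
  unfold mfEnergy kBmeV; constructor <;> norm_num

/-- … and `NdH₇` (`251 K`): `129.7 < ΔE < 129.8 meV`; `NdH₄` (`4 K`): `2.06 < ΔE < 2.07 meV`.
[cite: ZhouEtAl2020NdH9, SI p. 31 («4 K for NdH₄, 251 K for NdH₇ and 136 K for NdH₉»)] -/
theorem ndH7_ndH4_mf_energy :
    (129.7 < mfEnergy 6 251 ∧ mfEnergy 6 251 < 129.8) ∧ (2.06 < mfEnergy 6 4 ∧ mfEnergy 6 4 < 2.07) := by
  unfold mfEnergy kBmeV
  refine ⟨⟨by norm_num, by norm_num⟩, ⟨by norm_num, by norm_num⟩⟩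

/-! ## §5 The Rhodes–Wohlfarth ratio `p_C/p_s`: local-moment spectator vs itinerant-`f` ferromagnet -/

/-- THE RHODES–WOHLFARTH CARRIER MOMENT `p_C` (in `μ_B`, `g = 2`): the number defined from the paramagnetic Curie–Weiss
effective moment by `p_C (p_C + 2) = p_eff²` — the saturation moment `2S` a LOCAL spin `S` with that Curie constant
would carry — written as the explicit non-negative root `p_C = √(1 + p_eff²) − 1` (`pCarrier_spec`).
[cite: LiuIvanovskiPetrovic2017Fe3GeTe2, p. 5 («the Rhodes-Wohlfarth ratio (RWR) … defined as P_c/P_s with P_c obtained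
from the effective moment P_c(P_c+2) = P_eff² and P_s … the saturation moment … RWR is 1 for a localized system and is
larger in an itinerant system»; after Rhodes & Wohlfarth, Proc. R. Soc. A 273 (1963) 247)] -/
def pCarrier (peff : ℝ) : ℝ := Real.sqrt (1 + peff ^ 2) - 1

/-- THE RHODES–WOHLFARTH RATIO `p_C/p_s` (saturation / ordered moment `p_s` in `μ_B` per magnetic atom).
[cite: LiuIvanovskiPetrovic2017Fe3GeTe2, p. 5] -/
def rhodesWohlfarth (peff ps : ℝ) : ℝ := pCarrier peff / ps

/-- The defining equation: `p_C (p_C + 2) = p_eff²`. [cite: LiuIvanovskiPetrovic2017Fe3GeTe2, p. 5] -/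
theorem pCarrier_spec (peff : ℝ) : pCarrier peff * (pCarrier peff + 2) = peff ^ 2 := by
  unfold pCarrier
  have h : 0 ≤ 1 + peff ^ 2 := by positivity
  have hs := Real.mul_self_sqrt h
  have : (Real.sqrt (1 + peff ^ 2) - 1) * (Real.sqrt (1 + peff ^ 2) - 1 + 2) =
      Real.sqrt (1 + peff ^ 2) * Real.sqrt (1 + peff ^ 2) - 1 := by ring
  rw [this, hs]; ring

/-- `p_C ≥ 0`. [cite: LiuIvanovskiPetrovic2017Fe3GeTe2, p. 5] -/
theorem pCarrier_nonneg (peff : ℝ) : 0 ≤ pCarrier peff := by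
  unfold pCarrier
  have : (1 : ℝ) ≤ Real.sqrt (1 + peff ^ 2) := by
    rw [Real.le_sqrt' one_pos]; nlinarith [sq_nonneg peff]
  linarith

/-- Equivalently, `S* = p_C/2` is the «effective spin» whose spin-only `p² = 4S*(S*+1)` (`LocalMoment.spinOnlyPSq`)
reproduces the measured `p_eff²`. [cite: LiuIvanovskiPetrovic2017Fe3GeTe2, p. 5] -/
theorem spinOnlyPSq_half_pCarrier (peff : ℝ) : LocalMoment.spinOnlyPSq (pCarrier peff / 2) = peff ^ 2 := by
  unfold LocalMoment.spinOnlyPSq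
  linear_combination pCarrier_spec peff

/-- LOCAL-MOMENT CONSISTENCY («RWR is 1 for a localized system»): a spin-only moment `S ≥ 0` with
`p_eff = √(4S(S+1))` has `p_C = 2S` exactly. [cite: LiuIvanovskiPetrovic2017Fe3GeTe2, p. 5] -/
theorem pCarrier_spinOnly {S : ℝ} (hS : 0 ≤ S) : pCarrier (Real.sqrt (LocalMoment.spinOnlyPSq S)) = 2 * S := by
  unfold pCarrier LocalMoment.spinOnlyPSq
  have h0 : (0 : ℝ) ≤ 4 * (S * (S + 1)) := by positivity
  rw [Real.sq_sqrt h0]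
  have : (1 : ℝ) + 4 * (S * (S + 1)) = (2 * S + 1) ^ 2 := by ring
  rw [this, Real.sqrt_sq (by linarith)]
  ring

/-- … hence `p_C/p_s = 1` when the saturation moment is the same spin's `p_s = gS = 2S` (`S > 0`).
[cite: LiuIvanovskiPetrovic2017Fe3GeTe2, p. 5] -/
theorem rhodesWohlfarth_spinOnly {S : ℝ} (hS : 0 < S) :
    rhodesWohlfarth (Real.sqrt (LocalMoment.spinOnlyPSq S)) (2 * S) = 1 := by
  unfold rhodesWohlfarth
  rw [pCarrier_spinOnly hS.le]
  exact div_self (by positivity)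

/-- The `f⁷` free ion (`Eu²⁺ ≅ Gd³⁺`, ⁸S₇/₂, `L = 0`): `p² = 63` (`LocalMoment.pSq_Gd3`) ⇒ `p_C = 7 = gJ·J` exactly.
[cite: Kittel1971, ch. 15 Table 1 (Gd³⁺ row)] -/
theorem pCarrier_f7 : pCarrier (Real.sqrt (LocalMoment.hundPSq 3 7)) = 7 := by
  unfold pCarrier
  rw [Real.sq_sqrt (by rw [LocalMoment.pSq_Gd3]; norm_num), LocalMoment.pSq_Gd3]
  rw [show (1 : ℝ) + 63 = 8 ^ 2 by norm_num, Real.sqrt_sq (by norm_num)]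
  norm_num

/-- `p_C` is strictly increasing in `p_eff ≥ 0`. [cite: LiuIvanovskiPetrovic2017Fe3GeTe2, p. 5] -/
theorem pCarrier_lt_pCarrier {a b : ℝ} (ha : 0 ≤ a) (h : a < b) : pCarrier a < pCarrier b := by
  unfold pCarrier
  have : Real.sqrt (1 + a ^ 2) < Real.sqrt (1 + b ^ 2) := by
    apply Real.sqrt_lt_sqrt (by positivity)
    nlinarith
  linarith

/-- Helper: decidable bracket for `p_C` from brackets on `1 + p_eff²` (used by the witnesses below). [folklore] -/
private lemma pCarrier_bounds {peff lo hi : ℝ} (hlo : 0 ≤ lo + 1) (hhi : 0 < hi + 1)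
    (h1 : (lo + 1) ^ 2 < 1 + peff ^ 2) (h2 : 1 + peff ^ 2 < (hi + 1) ^ 2) :
    lo < pCarrier peff ∧ pCarrier peff < hi := by
  unfold pCarrier
  have a : lo + 1 < Real.sqrt (1 + peff ^ 2) := (Real.lt_sqrt hlo).mpr h1
  have b : Real.sqrt (1 + peff ^ 2) < hi + 1 := (Real.sqrt_lt' hhi).mpr h2
  constructor <;> linarith

/-! ### Witnesses: the three `f` situations of the hubbard-downfold R2 key by their Rhodes–Wohlfarth ratio -/

/-- `RbEuFe₄As₄` (DECOUPLED LOCAL-MOMENT `Eu²⁺` SPECTATOR): polycrystal Curie–Weiss `μ_eff = 7.95 μ_B` and saturation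
«6.5 μ_B/Eu, basically consistent with the expected value of gS = 7.0 μ_B/Eu» ⇒ **`7.01 < p_C < 7.02`** and
**`1.07 < p_C/p_s(6.5) < 1.08`, `p_C/p_s(7) < 1.003`** — ratio ≈ 1, the localized signature.
[cite: LiuEtAl2016RbEuFe4As4, p. 4–5 («6.5 μB/Eu … gS = 7.0», «μeff = 7.95 μB fu⁻¹»)] -/
theorem rbEuFe4As4_rhodesWohlfarth :
    (7.01 < pCarrier 7.95 ∧ pCarrier 7.95 < 7.02) ∧
      (1.07 < rhodesWohlfarth 7.95 6.5 ∧ rhodesWohlfarth 7.95 6.5 < 1.08) ∧ rhodesWohlfarth 7.95 7 < 1.003 := by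
  have hb : 7.01 < pCarrier 7.95 ∧ pCarrier 7.95 < 7.02 :=
    pCarrier_bounds (by norm_num) (by norm_num) (by norm_num) (by norm_num)
  refine ⟨hb, ⟨?_, ?_⟩, ?_⟩ <;> unfold rhodesWohlfarth
  · rw [lt_div_iff₀ (by norm_num)]; linarith [hb.1]
  · rw [div_lt_iff₀ (by norm_num)]; linarith [hb.2]
  · rw [div_lt_iff₀ (by norm_num)]; linarith [hb.2]

/-- `UGe₂` (the «DUALITY» row): «effective paramagnetic moment m_eff ≈ 2.7 μ_B/U which differs from atomic value of
3.62 μ_B for atomic f³ configuration» and ordered moment `1.42 μ_B` (Shick–Pickett's neutron/magnetisation value) /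
`M₀ = 1.48 μ_B` (Aoki–Ishida–Flouquet Table I) ⇒ **`1.879 < p_C < 1.880`**, **`p_C/p_s ∈ (1.26, 1.28)` with 1.48 and
`(1.32, 1.33)` with 1.42** — within 35 % of the local-moment value 1.
[cite: ShickPickett2001UGe2, p. 2 («m_eff ≈ 2.7 μB/U», «ferromagnetically ordered magnetic moment of 1.42 μB»)]
[cite: AokiIshidaFlouquet2019UFMSC, Table I (UGe₂: `T_Curie` 52 K, `M₀` 1.48 μB, `γ` 34 mJ mol⁻¹ K⁻²)] -/
theorem uGe2_rhodesWohlfarth :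
    (1.879 < pCarrier 2.7 ∧ pCarrier 2.7 < 1.880) ∧
      (1.26 < rhodesWohlfarth 2.7 1.48 ∧ rhodesWohlfarth 2.7 1.48 < 1.28) ∧
        (1.32 < rhodesWohlfarth 2.7 1.42 ∧ rhodesWohlfarth 2.7 1.42 < 1.33) := by
  have hb : 1.879 < pCarrier 2.7 ∧ pCarrier 2.7 < 1.880 :=
    pCarrier_bounds (by norm_num) (by norm_num) (by norm_num) (by norm_num)
  refine ⟨hb, ⟨?_, ?_⟩, ⟨?_, ?_⟩⟩ <;> unfold rhodesWohlfarth
  · rw [lt_div_iff₀ (by norm_num)]; linarith [hb.1]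
  · rw [div_lt_iff₀ (by norm_num)]; linarith [hb.2]
  · rw [lt_div_iff₀ (by norm_num)]; linarith [hb.1]
  · rw [div_lt_iff₀ (by norm_num)]; linarith [hb.2]

/-- `UGe₂`'s `2.7 μ_B` against the two free-ion candidates of `HundRulesEffectiveMoment.lean`: below BOTH `p(f³)`
(`LocalMoment.p_Nd3`: 3.61–3.62, the printed «3.62») and `p(f²)` (`LocalMoment.p_Pr3`: 3.57–3.58) — so the reduction
does not by itself pick `5f²` vs `5f³`. [cite: ShickPickett2001UGe2, p. 2] -/
theorem uGe2_muEff_below_free_ion :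
    (2.7 : ℝ) < Real.sqrt (LocalMoment.hundPSq 3 3) ∧ (2.7 : ℝ) < Real.sqrt (LocalMoment.hundPSq 3 2) :=
  ⟨by linarith [LocalMoment.p_Nd3.1], by linarith [LocalMoment.p_Pr3.1]⟩

/-- `UCoGe` (ITINERANT WEAK FERROMAGNET): Curie–Weiss `μ_eff = 1.7 μ_B` (Troć–Tran, via de la Mora–Navarro) against the
ordered moment BY SAMPLE `m₀ ∈ {0.03 (Huy 2007 polycrystal), 0.06 (review Table I), 0.07}` μ_B ⇒ **`0.972 < p_C < 0.973`**
and **`p_C/p_s ∈ [13.8, 32.5]` by sample** (`16.2 < · < 16.3` at 0.06) — an order of magnitude above 1, the itinerant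
signature. [cite: MoraNavarro2008UCoGe, p. 2 («μ_eff = 1.7 μB»)] [cite: AokiIshidaFlouquet2019UFMSC, Table I (UCoGe `M₀`
0.06 μB)] [cite: FujimoriEtAl2015UGe2UCoGeARPES, p. 1 («μ_ord = 0.03 μB, suggesting that UCoGe is an itinerant weak
ferromagnet»)] -/
theorem uCoGe_rhodesWohlfarth :
    (0.972 < pCarrier 1.7 ∧ pCarrier 1.7 < 0.973) ∧
      (16.2 < rhodesWohlfarth 1.7 0.06 ∧ rhodesWohlfarth 1.7 0.06 < 16.3) ∧
        (13.8 < rhodesWohlfarth 1.7 0.07 ∧ rhodesWohlfarth 1.7 0.03 < 32.5) := by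
  have hb : 0.972 < pCarrier 1.7 ∧ pCarrier 1.7 < 0.973 :=
    pCarrier_bounds (by norm_num) (by norm_num) (by norm_num) (by norm_num)
  refine ⟨hb, ⟨?_, ?_⟩, ⟨?_, ?_⟩⟩ <;> unfold rhodesWohlfarth
  · rw [lt_div_iff₀ (by norm_num)]; linarith [hb.1]
  · rw [div_lt_iff₀ (by norm_num)]; linarith [hb.2]
  · rw [lt_div_iff₀ (by norm_num)]; linarith [hb.1]
  · rw [div_lt_iff₀ (by norm_num)]; linarith [hb.2]

/-- THE ORDERING OF THE THREE ROWS: `RWR(RbEuFe₄As₄) < RWR(UGe₂) < RWR(UCoGe)` on the located values (poly `Eu`, `M₀`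
Table I for both uranium rows). [cite: AokiIshidaFlouquet2019UFMSC, Table I and §2.1 («the duality between the localized
and itinerant character of the 5f electron is strong in UGe₂, while an itinerant description … seems to be justified in
UCoGe»)] -/
theorem rhodesWohlfarth_ordering :
    rhodesWohlfarth 7.95 6.5 < rhodesWohlfarth 2.7 1.48 ∧ rhodesWohlfarth 2.7 1.48 < rhodesWohlfarth 1.7 0.06 := by
  constructor
  · linarith [rbEuFe4As4_rhodesWohlfarth.2.1.2, uGe2_rhodesWohlfarth.2.1.1]
  · linarith [uGe2_rhodesWohlfarth.2.1.2, uCoGe_rhodesWohlfarth.2.1.1]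

/-! ## §6 `URhGe` and the uranium ferromagnetic-superconductor triple ON ONE TABLE (hubbard-downfold rows M289 `UGe₂`,
M323 `URhGe`, M276 `UCoGe`)

Tateiwa et al. [TateiwaEtAl2017ActinideFM, TABLE I (own single crystals) and TABLE III] analyse 80 actinide ferromagnets with
Takahashi's spin-fluctuation theory and print, per compound, `T_C ∣ p_eff ∣ p_s ∣ p_eff/p_s ∣ F₁ ∣ T₀ ∣ T_A ∣ T_C/T₀`:
`UGe₂ 52.6 K ∣ 3.00 ∣ 1.41 ∣ 2.13 ∣ 554 ∣ 92.2 ∣ 442 ∣ 0.571`, `URhGe 9.47 ∣ 1.75 ∣ 0.407 ∣ 4.30 ∣ 1.10 × 10³ ∣ 78.4 ∣ 568 ∣ 0.121`,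
`UCoGe 2.4 ∣ 1.93 ∣ 0.039 ∣ 49.5 ∣ 2.87 × 10⁴ ∣ 362 ∣ 5.92 × 10³ ∣ 0.0065` («T_C/T₀ … from 0.0065 for UCoGe to 1.70 for
U₃TiSb₃. The degree of itinerancy of 5f electrons … largely differ», p. 7; `T_C/T₀ = 1` ⇔ local moment), and the
generalized Rhodes–Wohlfarth relation, Eq. (11): `p_eff/p_s ≃ 1.4 (T_C/T₀)^{−2/3}` (p. 4). This section certifies the §5
Rhodes–Wohlfarth ratio `p_C/p_s` of the three rows on that one table (`1.53 < 2.50 < 30.1`), `URhGe`'s ratio on the review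
members (`μ_eff = 1.8 μ_B/U`, Pfleiderer 2009 §III.A.2 citing Aoki 2001; `p_s` by source 0.42 / 0.40 / 0.35), the ordering
with `URhGe` BETWEEN `UGe₂` and `UCoGe` on either member set, Takahashi's Eq. (11) as a function with its cube identity and
its values at the three printed `T_C/T₀` (2.03 / 5.72 / 40.2 against the measured 2.13 / 4.30 / 49.5), and two small
arithmetic witnesses used by the hubbard-downfold M322 `(Li₀.₈Fe₀.₂)OHFeSe` packet (Nekrasov–Sadovskii's mean-field
`T_C = JzS(S+1)/3 = 10.4 K` from `J = 1.3 K`, `z = 4`, `S = 2`, convention (S); and `0.1 meV/k_B = 1.16 K`).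

WHAT THIS IS NOT: an endorsement of either `p_s` member, a statement about which compound is «more correlated» beyond the
printed itinerancy parameters, or a fit — every number is a certified reproduction of a printed one.

References for §6:
* N. Tateiwa, J. Pospíšil, Y. Haga, H. Sakai, T. D. Matsuda, E. Yamamoto, Phys. Rev. B 96 (2017) 035125,
  arXiv:1707.04772, TABLE I p. 6, TABLE III p. 8, Eq. (11) p. 4, p. 7. [TateiwaEtAl2017ActinideFM]
* C. Pfleiderer, Rev. Mod. Phys. 81 (2009) 1551, arXiv:0905.2625, §III.A.2 `URhGe` («μ_ord = 0.42 μ_B/U», «fluctuating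
  moment μ_eff = 1.8 μ_B/U [aoki01]»). [Pfleiderer2009fElectronSC]
* D. Aoki, K. Ishida, J. Flouquet, J. Phys. Soc. Jpn. 88 (2019) 022001, arXiv:1901.00684, Table I (`URhGe`: `M₀` 0.4 μ_B,
  `γ` 163). [AokiIshidaFlouquet2019UFMSC]
* P. de la Mora, O. Navarro, J. Phys.: Condens. Matter 20 (2008) 285221, arXiv:0709.2351, Tables 2–3 (`URhGe` column:
  U spin 1.037 / orbital −1.266 / total −0.348; with `U_H` 0.36 eV: 1.151 / −1.470 / −0.456). [MoraNavarro2008UCoGe]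
* I. A. Nekrasov, M. V. Sadovskii, JETP Lett. 101 (2015) 47, arXiv:1411.7194, p. 3 (`J = 1.3 K`, `S = 2`, `z = 4`,
  `T_C = JzS(S+1)/3 = 10.4 K`). [NekrasovSadovskii2015LiOHFeSe]
* D.-Y. Liu, Z. Sun, L.-J. Zou, New J. Phys. 19 (2017) 023028, arXiv:1702.03845, p. 12 (`J′₁ = 0.1 meV/S²`).
  [LiuSunZou2017LiFeOHFeSe]
-/

/-- `URhGe` ON THE REVIEW MEMBERS: easy-axis Curie–Weiss `μ_eff = 1.8 μ_B/U` against the ordered moment BY SOURCE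
`p_s ∈ {0.42 (RMP «μ_ord = 0.42 μB/U [aoki01, prok02]»), 0.40 (Aoki–Ishida–Flouquet Table I), 0.35 (Prokeš et al. 2002
polycrystal neutrons, moment in the b–c plane, as restated in the RMP's [tran98]/[prok02] discussion)}` ⇒
**`1.059 < p_C < 1.060`** and **RWR `(2.52, 2.53)` at 0.42, `(2.64, 2.65]` at 0.40, `(3.02, 3.03)` at 0.35** — between
`UGe₂` (§5: 1.26–1.33) and `UCoGe` (13.8–32.5). [cite: Pfleiderer2009fElectronSC, §III.A.2 URhGe (p. 36 of arXiv v: «μ_ord =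
0.42 μB/U», «μ_eff = 1.8 μB/U [aoki01] … strongly suggests itinerant ferromagnetism with strongly delocalized 5f electrons»)]
[cite: AokiIshidaFlouquet2019UFMSC, Table I (URhGe: c, 9.5 K, 0.4 μB, 163)] -/
theorem uRhGe_rhodesWohlfarth :
    (1.059 < pCarrier 1.8 ∧ pCarrier 1.8 < 1.060) ∧
      (2.52 < rhodesWohlfarth 1.8 0.42 ∧ rhodesWohlfarth 1.8 0.42 < 2.53) ∧
        (2.64 < rhodesWohlfarth 1.8 0.40 ∧ rhodesWohlfarth 1.8 0.40 ≤ 2.65) ∧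
          (3.02 < rhodesWohlfarth 1.8 0.35 ∧ rhodesWohlfarth 1.8 0.35 < 3.03) := by
  have hb : 1.059 < pCarrier 1.8 ∧ pCarrier 1.8 < 1.060 :=
    pCarrier_bounds (by norm_num) (by norm_num) (by norm_num) (by norm_num)
  refine ⟨hb, ⟨?_, ?_⟩, ⟨?_, ?_⟩, ⟨?_, ?_⟩⟩ <;> unfold rhodesWohlfarth
  · rw [lt_div_iff₀ (by norm_num)]; linarith [hb.1]
  · rw [div_lt_iff₀ (by norm_num)]; linarith [hb.2]
  · rw [lt_div_iff₀ (by norm_num)]; linarith [hb.1]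
  · rw [div_le_iff₀ (by norm_num)]; linarith [hb.2]
  · rw [lt_div_iff₀ (by norm_num)]; linarith [hb.1]
  · rw [div_lt_iff₀ (by norm_num)]; linarith [hb.2]

/-- THE THREE ROWS ON TATEIWA'S TABLE (`p_eff`, `p_s` from one analysis of single-crystal magnetisation): `UGe₂`
`p_eff 3.00 / p_s 1.41` ⇒ **`2.162 < p_C < 2.163`, RWR `(1.53, 1.54)`**; `URhGe` `1.75 / 0.407` ⇒ **`1.015 < p_C < 1.016`,
RWR `(2.49, 2.50)`**; `UCoGe` `1.93 / 0.039` (their Table III, cited from Deguchi et al. / Sato et al.) ⇒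
**`1.1736 < p_C < 1.1737`, RWR `(30.0, 30.1)`**. [cite: TateiwaEtAl2017ActinideFM, TABLE I p. 6 (UGe₂ 52.6 3.00 1.41 2.13 …
0.571; URhGe 9.47 1.75 0.407 4.30 … 0.121) and TABLE III p. 8 (UCoGe 2.4 1.93 0.039 49.5 … 0.0065)] -/
theorem tateiwa2017_rhodesWohlfarth :
    ((2.162 < pCarrier 3.00 ∧ pCarrier 3.00 < 2.163) ∧
        (1.53 < rhodesWohlfarth 3.00 1.41 ∧ rhodesWohlfarth 3.00 1.41 < 1.54)) ∧
      ((1.015 < pCarrier 1.75 ∧ pCarrier 1.75 < 1.016) ∧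
          (2.49 < rhodesWohlfarth 1.75 0.407 ∧ rhodesWohlfarth 1.75 0.407 < 2.50)) ∧
        ((1.1736 < pCarrier 1.93 ∧ pCarrier 1.93 < 1.1737) ∧
          (30.0 < rhodesWohlfarth 1.93 0.039 ∧ rhodesWohlfarth 1.93 0.039 < 30.1)) := by
  have h1 : 2.162 < pCarrier 3.00 ∧ pCarrier 3.00 < 2.163 :=
    pCarrier_bounds (by norm_num) (by norm_num) (by norm_num) (by norm_num)
  have h2 : 1.015 < pCarrier 1.75 ∧ pCarrier 1.75 < 1.016 :=
    pCarrier_bounds (by norm_num) (by norm_num) (by norm_num) (by norm_num)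
  have h3 : 1.1736 < pCarrier 1.93 ∧ pCarrier 1.93 < 1.1737 :=
    pCarrier_bounds (by norm_num) (by norm_num) (by norm_num) (by norm_num)
  refine ⟨⟨h1, ?_, ?_⟩, ⟨h2, ?_, ?_⟩, ⟨h3, ?_, ?_⟩⟩ <;> unfold rhodesWohlfarth
  · rw [lt_div_iff₀ (by norm_num)]; linarith [h1.1]
  · rw [div_lt_iff₀ (by norm_num)]; linarith [h1.2]
  · rw [lt_div_iff₀ (by norm_num)]; linarith [h2.1]
  · rw [div_lt_iff₀ (by norm_num)]; linarith [h2.2]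
  · rw [lt_div_iff₀ (by norm_num)]; linarith [h3.1]
  · rw [div_lt_iff₀ (by norm_num)]; linarith [h3.2]

/-- THE ORDERING WITH `URhGe` IN THE MIDDLE, on Tateiwa's one table AND on the review members (§5's `UGe₂` 2.7/1.48 and
`UCoGe` 1.7/0.06 with `URhGe` 1.8/0.42): `RWR(UGe₂) < RWR(URhGe) < RWR(UCoGe)` both ways — the same order as the
printed `T_C/T₀` (0.571 > 0.121 > 0.0065) and as `M₀` (1.41–1.48 > 0.40–0.42 > 0.04–0.06 μ_B).
[cite: TateiwaEtAl2017ActinideFM, TABLE I / TABLE III and p. 7 («degree of itinerancy»)]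
[cite: AokiIshidaFlouquet2019UFMSC, §2.1 («duality … strong in UGe₂, while an itinerant description … justified in UCoGe»)] -/
theorem uraniumTriple_rhodesWohlfarth_ordering :
    (rhodesWohlfarth 3.00 1.41 < rhodesWohlfarth 1.75 0.407 ∧
        rhodesWohlfarth 1.75 0.407 < rhodesWohlfarth 1.93 0.039) ∧
      (rhodesWohlfarth 2.7 1.48 < rhodesWohlfarth 1.8 0.42 ∧
        rhodesWohlfarth 1.8 0.42 < rhodesWohlfarth 1.7 0.06) := by
  obtain ⟨⟨_, _, a2⟩, ⟨_, b1, b2⟩, ⟨_, c1, _⟩⟩ := tateiwa2017_rhodesWohlfarth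
  refine ⟨⟨by linarith, by linarith⟩, ?_, ?_⟩
  · linarith [uGe2_rhodesWohlfarth.2.1.2, uRhGe_rhodesWohlfarth.2.1.1]
  · linarith [uRhGe_rhodesWohlfarth.2.1.2, uCoGe_rhodesWohlfarth.2.1.1]

/-- The printed numbers are monotone in the same sense on all three itinerancy axes of the table:
`T_C/T₀` (local-moment limit 1) DEcreasing `0.571 > 0.121 > 0.0065`, raw `p_eff/p_s` INcreasing `2.13 < 4.30 < 49.5`,
`p_s` DEcreasing `1.41 > 0.407 > 0.039` — while the Sommerfeld `γ` of the review's Table I is NOT monotone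
(`34 < 163 > 57` mJ mol⁻¹ K⁻²: `URhGe` is the heaviest of the three). [cite: TateiwaEtAl2017ActinideFM, TABLE I / III]
[cite: AokiIshidaFlouquet2019UFMSC, Table I (γ 34 / 163 / 57)] -/
theorem uraniumTriple_printed_axes :
    ((0.0065 : ℝ) < 0.121 ∧ (0.121 : ℝ) < 0.571) ∧ ((2.13 : ℝ) < 4.30 ∧ (4.30 : ℝ) < 49.5) ∧
      ((0.039 : ℝ) < 0.407 ∧ (0.407 : ℝ) < 1.41) ∧ ((34 : ℝ) < 163 ∧ (57 : ℝ) < 163) := by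
  norm_num

/-- TAKAHASHI'S GENERALIZED RHODES–WOHLFARTH RELATION as printed by Tateiwa et al., Eq. (11):
`p_eff/p_s ≃ 1.4 (T_C/T₀)^{−2/3}` (the prefactor `[1/(10 C_{4/3} dy/dt)]^{−1/2}` «is numerically estimated as ∼ 1.4»).
[cite: TateiwaEtAl2017ActinideFM, Eq. (11) p. 4] -/
def takahashiRW (r : ℝ) : ℝ := 1.4 * r ^ (-(2 / 3 : ℝ))

/-- `takahashiRW r > 0` for `r > 0`. [cite: TateiwaEtAl2017ActinideFM, Eq. (11)] -/
theorem takahashiRW_pos {r : ℝ} (hr : 0 < r) : 0 < takahashiRW r := by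
  unfold takahashiRW
  have := Real.rpow_pos_of_pos hr (-(2 / 3 : ℝ))
  positivity

/-- The cube identity that makes Eq. (11) decidable on rationals: `(1.4 r^{−2/3})³ · r² = 1.4³ = 2.744` (`r > 0`).
(So the arXiv abstract's exponent «−3/2» is a misprint for the text's `−2/3`: at `URhGe`'s `T_C/T₀ = 0.121` the `−2/3`
law gives 5.7, the `−3/2` law 33, against the tabulated 4.30.) [cite: TateiwaEtAl2017ActinideFM, Eq. (11) p. 4 vs
abstract p. 1] -/
theorem takahashiRW_cube {r : ℝ} (hr : 0 < r) : takahashiRW r ^ 3 * r ^ 2 = 2.744 := by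
  unfold takahashiRW
  have h1 : (r ^ (-(2 / 3 : ℝ))) ^ 3 = r ^ (-2 : ℝ) := by
    rw [← Real.rpow_natCast (r ^ (-(2 / 3 : ℝ))) 3, ← Real.rpow_mul hr.le]
    norm_num
  have h2 : r ^ (-2 : ℝ) = (r ^ 2)⁻¹ := by
    rw [Real.rpow_neg hr.le, Real.rpow_two]
  have hr2 : r ^ 2 ≠ 0 := by positivity
  rw [mul_pow, h1, h2]
  field_simp
  norm_num

/-- Helper: a cube window. [folklore] -/
private lemma window_of_cube {y lo hi c : ℝ} (hy : 0 ≤ y) (hhi : 0 ≤ hi) (h : y ^ 3 = c)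
    (h1 : lo ^ 3 < c) (h2 : c < hi ^ 3) : lo < y ∧ y < hi := by
  constructor
  · exact lt_of_pow_lt_pow_left₀ 3 hy (by rw [h]; exact h1)
  · exact lt_of_pow_lt_pow_left₀ 3 hhi (by rw [h]; exact h2)

/-- Eq. (11) AT THE THREE PRINTED `T_C/T₀`: `UGe₂` (0.571) **`2.03 < 1.4 r^{−2/3} < 2.04`** vs measured `p_eff/p_s = 2.13`;
`URhGe` (0.121) **`5.72 < · < 5.73`** vs `4.30`; `UCoGe` (0.0065) **`40.1 < · < 40.2`** vs `49.5` — all three within the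
scatter of the printed log–log plot (their Fig. 3), none on the line (+5 % / −25 % / +23 %).
[cite: TateiwaEtAl2017ActinideFM, Eq. (11) p. 4, TABLE I p. 6, TABLE III p. 8, Fig. 3 p. 9] -/
theorem takahashiRW_at_printed_ratios :
    (2.03 < takahashiRW 0.571 ∧ takahashiRW 0.571 < 2.04) ∧
      (5.72 < takahashiRW 0.121 ∧ takahashiRW 0.121 < 5.73) ∧
        (40.1 < takahashiRW 0.0065 ∧ takahashiRW 0.0065 < 40.2) := by
  have c1 := takahashiRW_cube (show (0 : ℝ) < 0.571 by norm_num)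
  have c2 := takahashiRW_cube (show (0 : ℝ) < 0.121 by norm_num)
  have c3 := takahashiRW_cube (show (0 : ℝ) < 0.0065 by norm_num)
  have e1 : takahashiRW 0.571 ^ 3 = 2.744 / 0.571 ^ 2 := by
    rw [eq_div_iff (by norm_num)]; exact c1
  have e2 : takahashiRW 0.121 ^ 3 = 2.744 / 0.121 ^ 2 := by
    rw [eq_div_iff (by norm_num)]; exact c2
  have e3 : takahashiRW 0.0065 ^ 3 = 2.744 / 0.0065 ^ 2 := by
    rw [eq_div_iff (by norm_num)]; exact c3
  refine ⟨?_, ?_, ?_⟩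
  · exact window_of_cube (takahashiRW_pos (by norm_num)).le (by norm_num) e1 (by norm_num) (by norm_num)
  · exact window_of_cube (takahashiRW_pos (by norm_num)).le (by norm_num) e2 (by norm_num) (by norm_num)
  · exact window_of_cube (takahashiRW_pos (by norm_num)).le (by norm_num) e3 (by norm_num) (by norm_num)

/-- … and the measured-vs-Eq. (11) comparison as inequalities: `UGe₂` and `UCoGe` ABOVE the line, `URhGe` BELOW it.
[cite: TateiwaEtAl2017ActinideFM, TABLE I / III vs Eq. (11)] -/
theorem takahashiRW_vs_measured :
    takahashiRW 0.571 < 2.13 ∧ 4.30 < takahashiRW 0.121 ∧ takahashiRW 0.0065 < 49.5 := by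
  obtain ⟨⟨_, a⟩, ⟨b, _⟩, ⟨_, c⟩⟩ := takahashiRW_at_printed_ratios
  exact ⟨by linarith, by linarith, by linarith⟩

/-- THE `URhGe` FM + SOC CONSTRUCTION PAIR of de la Mora–Navarro (WIEN2k PBE-GGA + SOC, moment ∥ c; the only opened
numbers a hubbard-downfold D10 leg is read against): U-site `|m_l|/|m_s| = 1.266/1.037 ∈ (1.22, 1.23)` (GGA) and
`1.470/1.151 ∈ (1.27, 1.28)` (`+U_H` 0.36 eV); the printed totals `0.348 → 0.456 μ_B` BRACKET the measured `0.40–0.42`,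
a `+31 %` move (`1.31 < 0.456/0.348 < 1.32`); and a scalar-relativistic spin-only leg would return the U spin moment
alone, `1.037/0.42 ∈ (2.46, 2.47)` to `1.151/0.40 ∈ (2.87, 2.88)` times the measurement — the located reason the
spin–orbit member is the record for this row. [cite: MoraNavarro2008UCoGe, Table 2 (URhGe c-column: spin U 1.037, orbital
U −1.266, total −0.348) and Table 3 (U_H: 1.151 / −1.470 / −0.456; «quite close to the experimental value … 0.42 μB»)]
[cite: Pfleiderer2009fElectronSC, §III.A.2 («ordered moment is the result of strongly opposing spin and orbital
contributions»)] -/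
theorem delaMoraNavarro2008_URhGe_momentPair :
    ((1.22 : ℝ) < 1.266 / 1.037 ∧ (1.266 : ℝ) / 1.037 < 1.23) ∧
      ((1.27 : ℝ) < 1.470 / 1.151 ∧ (1.470 : ℝ) / 1.151 < 1.28) ∧
        ((0.348 : ℝ) < 0.40 ∧ (0.42 : ℝ) < 0.456 ∧ (1.31 : ℝ) < 0.456 / 0.348 ∧ (0.456 : ℝ) / 0.348 < 1.32) ∧
          ((2.46 : ℝ) < 1.037 / 0.42 ∧ (1.037 : ℝ) / 0.42 < 2.47 ∧
            (2.87 : ℝ) < 1.151 / 0.40 ∧ (1.151 : ℝ) / 0.40 < 2.88) := by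
  norm_num

/-! ### Two mean-field witnesses for the hubbard-downfold M322 `(Li₀.₈Fe₀.₂)OHFeSe` packet -/

/-- Nekrasov–Sadovskii's hydroxide-layer Curie temperature: LSDA nearest-neighbour `J = 1.3 K` (ferromagnetic), `S = 2`
(Fe²⁺), `z = 4`, «T_C = JzS(S+1)/3 = 10.4 K» — convention (S), exactly `thetaSingle 4 1.3 2 = 10.4`.
[cite: NekrasovSadovskii2015LiOHFeSe, p. 3 («J = 1.3 K … S = 2 … T_C = JzS(S+1)/3 = 10.4 K (where z = 4 …)», vs the
measured «T_C = 10 K [9]»)] -/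
theorem nekrasovSadovskii2015_LiOHFeSe_TCurie : thetaSingle 4 1.3 2 = 10.4 := by
  unfold thetaSingle spinSq
  norm_num

/-- Liu–Sun–Zou's hydroxide-layer `J′₁ = 0.1 meV/S²` in kelvin: **`1.160 < 0.1/k_B < 1.161 K`** — the same scale as
Nekrasov–Sadovskii's `1.3 K` (opposite sign convention: their positive `J′` favours antiferromagnetism).
[cite: LiuSunZou2017LiFeOHFeSe, p. 12 («J′₁ = 0.1 meV/S², J′₂ = 0.11 meV/S², and J_c = −0.54 meV/Ss»)]
[cite: BIPM2019, §2.2 Table 1] -/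
theorem liuSunZou2017_Jprime_kelvin : 1.160 < 0.1 / kBmeV ∧ 0.1 / kBmeV < 1.161 := by
  obtain ⟨h1, h2⟩ := kBmeV_bounds
  have hpos : 0 < kBmeV := by linarith
  constructor
  · rw [lt_div_iff₀ hpos]; nlinarith
  · rw [div_lt_iff₀ hpos]; nlinarith

end CurieWeiss

end Literature.MathematicalPhysics.QuantumManyBody

end
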